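import Summits.CriticalPhenomena.CardyFormulaZ2.Theses.UnionJackBeffara
import Summits.CriticalPhenomena.CardyFormulaZ2.Theorems.CardyFlipRussoCoveringLegWideBridge
import Literature.Probability.LatticeModels.MeshDomainJordan
import Literature.Probability.Percolation.DiscreteDomainPaths
import HarnessLib

/-!
# Birth skeleton for the crux `UnionJackBeffara.CoveringBridge` (stmt-CriticalPhenomena-4560)

Route `UnionJackBeffara`, sub-problem `CriticalPhenomena/CardyFormulaZ2`, crux item stmt-CriticalPhenomena-4560
(`Summit.CriticalPhenomena.CardyFormulaZ2.Theses.UnionJackBeffara.CoveringBridge`, shared with route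
`DWavePairKernel`): if the crude `P_{1/2,0}` crossing probability on `δG_s` (Kesten's covering encoding of
bond-`ℤ²`) converges to Cardy's `F(η)` for EVERY conformal rectangle, then G02's `bondDomainCrossingProb R δ`
(bond-`ℤ²` at `½`, LARGEST mesh component `Ω_δ`, discrete arcs by distance comparison) converges to `F(η)` for
every `R` — i.e. the conjunct `CardyFormulaZ2` itself.

WHAT THE TREE ALREADY PROVES (used verbatim in `CoveringBridge_of`, nothing re-proved):
* `wide_tendsto_sub` (Theorems/CardyFlipRussoCoveringLegWideBridge): the Union-Jack crude `P_{1/2,0}` crossing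
  probability at mesh `√2·δ` and the crude bond-`ℤ²` probability `bondProb R δ`
  (`embDomainCrossing squareLatticeEmbedding.z`, lattice positions `δ√2·x`) differ by `o(1)` — Kesten's covering
  dictionary is DONE; what is left of the crux is pure square-lattice discretisation robustness;
* `stub_CrudeCrossingContinuity_of_SS` ∘ `QuadCrossing.SchrammSmirnov2011_lemma_5_1_holds`
  (Theorems/CardyIKTransportCornerLineDescentCrudeContinuity, Literature/…/QuadCrossingContinuityEventsDischarge):
  `Freeze.CrudeCrossingContinuity R` — for every `ε > 0` there are `κ, ρ > 0` with
  `P_{1/2}[Freeze.upperCrossing R ρ δ] ≤ P_{1/2}[Freeze.lowerCrossing R κ ρ δ] + ε` for all small `δ`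
  (mesh-uniform insensitivity of crude bond-`ℤ²` crossings to a collar perturbation of the domain);
* `Freeze.embDomainCrossing_subset_upperCrossing`, `Freeze.lowerCrossing_subset_embDomainCrossing`: the crude
  event sits between the thinned and the fattened event;
* `tendsto_comp_const_mul_iff` (Theorems/CardyFlipRussoCoveringLegTwins): a limit `δ → 0⁺` may be read at
  mesh `√2·δ` (G02's `meshPoint (√2·δ) x = δ · squareLatticeEmbedding.z x`).

THE LINE (two stubs = the two halves of the fixed-mesh sandwich of G02's DISCRETE event between the same two
Freeze events; with the items above they give `|bondDomainCrossingProb R (√2δ) − bondProb R δ| ≤ ε` eventually,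
hence the crux):
* `stub_discreteCrossing_subset_upper` — UPPER inclusion, deterministic, every mesh: a G02 discrete crossing of
  `R` at mesh `√2·δ` is a fattened crude crossing at Freeze-mesh `δ` once `2δ ≤ ρ` (discrete-arc vertices are
  within one mesh of their arc: `exists_mem_frontier_of_mem_meshBoundary`, `R.iUnion_arc_holds`; vertices of
  `Ω_δ` lie in `Ω`; walk transport `openGraph ω ⊓ discreteDomainGraph → openConnIn`). Size S/M.
* `stub_lower_subset_discreteCrossing` — LOWER inclusion, for configurations on lattice edges (a.s.) and all
  small `δ` (depending on `R, κ, ρ`): a thinned collar-to-collar crossing contains an open walk of interior mesh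
  edges from a vertex of the discrete arc of `(ab)` to a vertex of the discrete arc of `(cd)`, all inside the
  LARGEST component — label the non-mesh edges of the walk by the arc (`0` or `2`) their segment meets (the
  `ρ`-balls keep arcs `1, 3` away), take a consecutive `0`-then-`2` pair, and put the run in `meshDomain` by the
  tree's bulk theorem `JordanDomain.exists_forall_mem_meshDomain_and_reachable` (Osgood boundaries included)
  applied to `K = {z : infDist z Ωᶜ ≥ min ρ (dist(arc 0, arc 2)/3)}`. Size M/L; the HARDEST stub.

Disproof used: none relevant — `ledger crux ls stmt-CriticalPhenomena-4560` shows no `Disproof.lean` / Negative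
lemmas for this crux (2026-08-17). Neither stub is the crux or the summit reworded: both are deterministic
statements about ONE configuration at ONE mesh (no limits, no Cardy function), BC3 probes recorded in the
planner's NOTES.md.

References: H. Kesten, *Percolation theory for mathematicians* (1982) §3.4 [KestenPTM1982]; B. Bollobás,
O. Riordan, *Percolation* (2006) Ch. 7 Lemma 14 [BollobasRiordan2006]; O. Schramm, S. Smirnov, Ann. Probab. 39
(2011) Lemma 5.1 [SchrammSmirnov2011]; S. Smirnov, C. R. Acad. Sci. 333 (2001) §2 (the discretisation `Ω_δ`)
[Smirnov2001]; G. Grimmett, *Probability on Graphs* (2018) §5.7 [Grimmett2018].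
-/

noncomputable section

namespace Summit.CriticalPhenomena.CardyFormulaZ2.Cruxes.CoveringBridge.Birth

open MeasureTheory Filter Set Topology
open Literature.Probability.RandomPlanarGeometry Literature.Probability.Percolation
open Literature.Probability.LatticeModels
open Summit.CriticalPhenomena.CardyFormulaZ2.Theses
open Summit.CriticalPhenomena.CardyFormulaZ2.Theorems.CornerLineDescent.SymmetricSeed
open Summit.CriticalPhenomena.CardyFormulaZ2.Cruxes.CoveringLeg.FiveArmNull

/-! ### Name-keyed signatures of the two stubs (the hypotheses of the composition)

The skeleton audit (`#h21_check_skeleton`, HarnessLib/Audit/Check.lean) admits as hypotheses of the composition exactly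
the registered obligations and the declared stubs BY NAME; these reducible aliases key each stub statement by its stub
name (pattern of `Cruxes/AnisotropicBoxCardy/Lines/birth.lean`, `Cruxes/BoxFamilyToCardy/Lines/birth.lean`). The text
of each alias is VERBATIM the signature of the corresponding `theorem stub_…` below. -/
namespace Sig

/-- Signature of `stub_discreteCrossing_subset_upper` (upper inclusion), keyed by the stub name. -/
abbrev stub_discreteCrossing_subset_upper : Prop :=
  ∀ (R : ConformalRectangle) (ρ δ : ℝ), 0 < δ → 2 * δ ≤ ρ →
    discreteCrossing R.carrier (Real.sqrt 2 * δ) (R.arc 0) (R.arc 2) ⊆ Freeze.upperCrossing R ρ δ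

/-- Signature of `stub_lower_subset_discreteCrossing` (lower inclusion), keyed by the stub name. -/
abbrev stub_lower_subset_discreteCrossing : Prop :=
  ∀ (R : ConformalRectangle) (κ ρ : ℝ), 0 < κ → 0 < ρ →
    ∀ᶠ δ in 𝓝[>] (0 : ℝ), ∀ ω : BondConfig (Site 2), ω ⊆ (zdGraph 2).edgeSet →
      ω ∈ Freeze.lowerCrossing R κ ρ δ →
        ω ∈ discreteCrossing R.carrier (Real.sqrt 2 * δ) (R.arc 0) (R.arc 2)

end Sig

/-! ### The two registered stubs (the ONLY sorries of this file) -/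

/-- STUB 1 (upper inclusion; deterministic, every mesh). For every conformal rectangle `R`, every `δ > 0` and every
collar width `ρ ≥ 2δ`, G02's discrete crossing event of `R` at mesh `√2·δ` (open path of the LARGEST mesh
component `Ω_{√2δ}` from the discrete arc of `(ab) = R.arc 0` to the discrete arc of `(cd) = R.arc 2`) is contained
in the fattened crude event `Freeze.upperCrossing R ρ δ` (open `ℤ²`-path with all vertices within `ρ` of `Ω`,
from within `ρ` of `arc 0` to within `ρ` of `arc 2`; lattice positions `δ · squareLatticeEmbedding.z x =
meshPoint (√2δ) x`). WHY TRUE: vertices of `Ω_δ` have mesh points in `Ω`; a discrete-arc vertex is a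
discrete-boundary vertex, hence within one mesh `√2δ ≤ 2δ ≤ ρ` of `∂Ω = ⋃ arcs`, and at least as close to its
arc as to the rest of `∂Ω`, hence within one mesh of its arc; a walk of `openGraph ω ⊓ discreteDomainGraph` is an
open walk inside the window. [folklore] -/
theorem stub_discreteCrossing_subset_upper :
    ∀ (R : ConformalRectangle) (ρ δ : ℝ), 0 < δ → 2 * δ ≤ ρ →
      discreteCrossing R.carrier (Real.sqrt 2 * δ) (R.arc 0) (R.arc 2) ⊆ Freeze.upperCrossing R ρ δ := by
  sorry

/-- STUB 2 (lower inclusion; configurations on lattice edges, all small meshes — the HARDEST stub). For every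
conformal rectangle `R` and all `κ, ρ > 0`, for all sufficiently small `δ > 0` (depending on `R, κ, ρ`): every
configuration `ω ⊆ E(ℤ²)` in the thinned collar-to-collar crude event `Freeze.lowerCrossing R κ ρ δ` (open
`ℤ²`-path whose vertices' closed `ρ`-balls lie in `Ω ∪ collar₀ ∪ collar₂`, from a vertex whose ball lies in
`collar₀ ∖ Ω` to one whose ball lies in `collar₂ ∖ Ω`) lies in G02's discrete crossing event of `R` at mesh
`√2·δ`. WHY TRUE: classify the walk's non-interior-mesh edges by the arc (`0` or `2`; arcs `1, 3` do not meet the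
balls) that their segment meets; the first edge is of type `0`, the last of type `2`; between a consecutive
`0`-edge and `2`-edge the walk is an open walk of interior mesh edges whose end vertices are discrete-boundary
candidates within one mesh of `arc 0`, resp. `arc 2`, and farther than one mesh from the other arcs
(`δ ≤ min κ ρ`, `2δ < dist (arc 0) (arc 2)`); the run passes through `{z | infDist z Ωᶜ ≥ min ρ (d/3)}`, so by
`JordanDomain.exists_forall_mem_meshDomain_and_reachable` it lies in the largest component `meshDomain`, which
makes its ends genuine `discreteArc` vertices and its edges `discreteDomainGraph` edges
(`DiscreteDomainPaths.reachable_of_walk`). [folklore] -/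
theorem stub_lower_subset_discreteCrossing :
    ∀ (R : ConformalRectangle) (κ ρ : ℝ), 0 < κ → 0 < ρ →
      ∀ᶠ δ in 𝓝[>] (0 : ℝ), ∀ ω : BondConfig (Site 2), ω ⊆ (zdGraph 2).edgeSet →
        ω ∈ Freeze.lowerCrossing R κ ρ δ →
          ω ∈ discreteCrossing R.carrier (Real.sqrt 2 * δ) (R.arc 0) (R.arc 2) := by
  sorry

/-! ### The kernel-checked composition: the two stubs give the crux BY NAME -/

/-- **`CoveringBridge` from the two stubs** (real proof, no `sorry`; hypotheses = the two stub signatures, keyed by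
name through `Sig.…`). Given crude `P_{1/2,0}` Cardy for every
conformal rectangle: (1) the crude bond-`ℤ²` probabilities `bondProb R δ` converge to `F(η)` (read the Union-Jack
statement at mesh `√2·δ` and subtract the PROVED wide covering null `wide_tendsto_sub`); (2) for `ε > 0` the
PROVED `Freeze.CrudeCrossingContinuity R` gives `κ, ρ` with `P[upper] ≤ P[lower] + ε/2` eventually; both
`bondDomainCrossingProb R (√2δ)` (by the two stubs) and `bondProb R δ` (tree) lie in `[P[lower], P[upper]]`, so
they differ by at most `ε/2` eventually, whence `bondDomainCrossingProb R (√2δ) → F(η)`; (3) undo the mesh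
change `δ ↦ √2δ`. [cite: KestenPTM1982, §3.4] [cite: BollobasRiordan2006, Ch. 7 Lemma 14] -/
theorem CoveringBridge_of (hU : Sig.stub_discreteCrossing_subset_upper)
    (hL : Sig.stub_lower_subset_discreteCrossing) : UnionJackBeffara.CoveringBridge := by
  rw [unionJackBeffara_coveringBridge_iff]
  intro h0 R φ x hφ
  -- (1) crude bond-ℤ² crossing probabilities converge to Cardy's value
  have hcrude : Tendsto (bondProb R) (𝓝[>] 0) (𝓝 (cardyFunction (crossRatio x))) := by
    have h1 : Tendsto (fun δ : ℝ => ujCrossingProb 0 R (Real.sqrt 2 * δ)) (𝓝[>] 0)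
        (𝓝 (cardyFunction (crossRatio x))) :=
      (tendsto_comp_const_mul_iff (f := ujCrossingProb 0 R) (Real.sqrt_pos.2 two_pos)).2 (h0 R φ x hφ)
    have h2 := h1.sub (wide_tendsto_sub R)
    rw [sub_zero] at h2
    refine h2.congr' (Eventually.of_forall fun δ => ?_)
    simp only [sub_sub_cancel]
  -- (2) G02's probabilities at mesh √2·δ converge to the same value
  have hdisc : Tendsto (fun δ : ℝ => bondDomainCrossingProb R (Real.sqrt 2 * δ)) (𝓝[>] 0)
      (𝓝 (cardyFunction (crossRatio x))) := by
    rw [Metric.tendsto_nhds] at hcrude ⊢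
    intro ε hε
    obtain ⟨κ, hκ, ρ, hρ, hev⟩ :=
      stub_CrudeCrossingContinuity_of_SS QuadCrossing.SchrammSmirnov2011_lemma_5_1_holds R (ε / 2) (half_pos hε)
    have hδ₀ : (0 : ℝ) < min (κ / 2) (ρ / 4) := lt_min (half_pos hκ) (by positivity)
    filter_upwards [hev, hL R κ ρ hκ hρ, hcrude (ε / 2) (half_pos hε), Ioo_mem_nhdsGT hδ₀] with δ hC hLδ hcr hδI
    have hδ : 0 < δ := hδI.1
    have hδκ : 2 * δ ≤ κ := by
      have h := lt_of_lt_of_le hδI.2 (min_le_left _ _)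
      linarith
    have hδρ : 4 * δ ≤ ρ := by
      have h := lt_of_lt_of_le hδI.2 (min_le_right _ _)
      linarith
    have hsq : Real.sqrt 2 * δ ≤ κ := by
      have h2 : Real.sqrt 2 ≤ 2 := (Real.sqrt_le_left zero_le_two).2 (by norm_num)
      nlinarith
    have hae : ∀ᵐ η ∂ bondPercolation (zdGraph 2) half, η ⊆ (zdGraph 2).edgeSet :=
      ProbabilityTheory.setBernoulli_ae_subset
    -- discrete ≤ upper (stub 1)
    have h1 : bondDomainCrossingProb R (Real.sqrt 2 * δ) ≤
        (bondPercolation (zdGraph 2) half).real (Freeze.upperCrossing R ρ δ) := by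
      rw [bondDomainCrossingProb_eq_measureReal]
      exact measureReal_mono (hU R ρ δ hδ (by linarith))
    -- lower ≤ discrete (stub 2, a.s.)
    have h2 : (bondPercolation (zdGraph 2) half).real (Freeze.lowerCrossing R κ ρ δ) ≤
        bondDomainCrossingProb R (Real.sqrt 2 * δ) := by
      rw [bondDomainCrossingProb_eq_measureReal]
      refine ENNReal.toReal_mono (measure_ne_top _ _) (measure_mono_ae ?_)
      filter_upwards [hae] with η hη hLη
      exact hLδ η hη hLη
    -- crude ≤ upper (tree)
    have h3 : bondProb R δ ≤ (bondPercolation (zdGraph 2) half).real (Freeze.upperCrossing R ρ δ) :=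
      measureReal_mono (Freeze.embDomainCrossing_subset_upperCrossing R hδ.le (by linarith))
    -- lower ≤ crude (tree, a.s.)
    have h4 : (bondPercolation (zdGraph 2) half).real (Freeze.lowerCrossing R κ ρ δ) ≤ bondProb R δ := by
      refine ENNReal.toReal_mono (measure_ne_top _ _) (measure_mono_ae ?_)
      filter_upwards [hae] with η hη hLη
      exact Freeze.lowerCrossing_subset_embDomainCrossing R hδ hρ.le hsq hη hLη
    rw [Real.dist_eq, abs_sub_lt_iff] at hcr ⊢
    constructor <;> linarith [hcr.1, hcr.2]
  -- (3) undo the change of mesh variable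
  exact (tendsto_comp_const_mul_iff (f := bondDomainCrossingProb R) (Real.sqrt_pos.2 two_pos)).1 hdisc

/-- Consistency: each alias IS its stub (definitionally) — the stubs inhabit the aliases. [folklore] -/
theorem sig_of_stubs : Sig.stub_discreteCrossing_subset_upper ∧ Sig.stub_lower_subset_discreteCrossing :=
  ⟨stub_discreteCrossing_subset_upper, stub_lower_subset_discreteCrossing⟩

/-- The composition fed with the two stubs concludes the ROUTE DECL by name (proof-of-item anchor; open only through
the two stub `sorry`s). [folklore] -/
theorem CoveringBridge_of_stubs : UnionJackBeffara.CoveringBridge :=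
  CoveringBridge_of stub_discreteCrossing_subset_upper stub_lower_subset_discreteCrossing

end Summit.CriticalPhenomena.CardyFormulaZ2.Cruxes.CoveringBridge.Birth

end
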